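import Mathlib
import HarnessLib

/-!
# CONSTANT BOOKKEEPING for the `stub_end_gaussCore` assembly (step (ε) of w3 g67's SPEC 2026-08-31 22:57Z = LEAD memo11 §3 b-powers):
# the leader prefactor `K(c) = π²/c₁·π²/c₂·2C₃/((1+c₃)√(1+c₃))` is `≤ 2π⁴C₃·κ₁κ₂κ₃√κ₃ · b⁻²·(b√b)⁻¹` for rates `cᵢ = b/κᵢ`, and the follower Gaussian prefactor
# `(2π/((1−1/(2d))b))^{d/2}` is `≤ (4/3)·(2π/b)^{d/2}` for `d ≥ 2` (Bernoulli) — so slab prefactors are `poly(L)·b^{−7/2}·(2π/b)^{d/2} = poly(L)(2π)^{−7/2}(2π/b)^{α}`.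
(free-hands support of ⟨stmt-QuantumFields-24197⟩ `SwapVirialDeficit.SwapGluedStiffness`)

* `leaderK_le` — `0 < b`, `0 < κᵢ`, `0 ≤ C`: `π²/(b/κ₁)·(π²/(b/κ₂))·(2C/((1+b/κ₃)√(1+b/κ₃))) ≤ π²κ₁·(π²κ₂)·(2C·(κ₃√κ₃))·(b⁻¹·b⁻¹·(b√b)⁻¹)`;
* `one_sub_inv_two_mul_rpow_ge` — `2 ≤ d`: `3/4 ≤ (1 − 1/(2d))^{d/2}` (✓`one_add_mul_self_le_rpow_one_add`); ★ `folGauss_prefactor_le` — `(2π/((1−1/(2d))b))^{d/2} ≤ (4/3)(2π/b)^{d/2}`;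
* `b_pow_combine` — `b^{−7/2}·(2π/b)^{d/2} = (2π)^{−7/2}·(2π/b)^{(7+d)/2}` (`0 < b`).

HONEST LABEL: real arithmetic; `stub_end_gaussCore` (N2 w2, shell g48, final assembly) and `stub_core_tip`, ⟨24197⟩ ∕ ⟨24194⟩ and every rung OPEN; own crux ⟨22884⟩ OPEN
(blocked-on ⟨19935⟩); the Yang–Mills mass gap is NOT proved; no summit is proved by a line.  THEOREMS ONLY (0 `def`, 0 `sorry`), standard axioms.
Width seat ym-line-sfw-p2-w3 g67 (cell ym-idea-1, free hands), `--supports stmt-QuantumFields-24197`.  References: [folklore].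
-/

set_option autoImplicit false

noncomputable section

open Real

namespace Summit.QuantumFields.YangMills.Theorems.SwapVirialDeficit.SigmaBall

/-- The leader prefactor with rates `cᵢ = b/κᵢ`: `π²/c₁·(π²/c₂)·(2C/((1+c₃)√(1+c₃))) ≤ π²κ₁·(π²κ₂)·(2Cκ₃√κ₃)·(b⁻¹·b⁻¹·(b√b)⁻¹)`. [folklore] -/
theorem leaderK_le {b κ₁ κ₂ κ₃ C : ℝ} (hb : 0 < b) (hκ₁ : 0 < κ₁) (hκ₂ : 0 < κ₂) (hκ₃ : 0 < κ₃) (hC : 0 ≤ C) :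
    π ^ 2 / (b / κ₁) * (π ^ 2 / (b / κ₂)) * (2 * C / ((1 + b / κ₃) * Real.sqrt (1 + b / κ₃))) ≤
      π ^ 2 * κ₁ * (π ^ 2 * κ₂) * (2 * C * (κ₃ * Real.sqrt κ₃)) * (b⁻¹ * b⁻¹ * (b * Real.sqrt b)⁻¹) := by
  have hc₃ : 0 < b / κ₃ := div_pos hb hκ₃
  have e1 : π ^ 2 / (b / κ₁) = π ^ 2 * κ₁ * b⁻¹ := by field_simp
  have e2 : π ^ 2 / (b / κ₂) = π ^ 2 * κ₂ * b⁻¹ := by field_simp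
  -- `(1+c)√(1+c) ≥ c√c = (b/κ₃)·√(b/κ₃)` and `√(b/κ₃) = √b/√κ₃`
  have hs : Real.sqrt (b / κ₃) ≤ Real.sqrt (1 + b / κ₃) := Real.sqrt_le_sqrt (by linarith)
  have hs0 : 0 < Real.sqrt (b / κ₃) := Real.sqrt_pos.2 hc₃
  have hlow : b / κ₃ * Real.sqrt (b / κ₃) ≤ (1 + b / κ₃) * Real.sqrt (1 + b / κ₃) :=
    mul_le_mul (by linarith) hs hs0.le (by linarith)
  have h3 : 2 * C / ((1 + b / κ₃) * Real.sqrt (1 + b / κ₃)) ≤ 2 * C / (b / κ₃ * Real.sqrt (b / κ₃)) :=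
    div_le_div_of_nonneg_left (by positivity) (by positivity) hlow
  have e3 : 2 * C / (b / κ₃ * Real.sqrt (b / κ₃)) = 2 * C * (κ₃ * Real.sqrt κ₃) * (b * Real.sqrt b)⁻¹ := by
    rw [Real.sqrt_div' b hκ₃.le]  -- √(b/κ₃) = √b/√κ₃
    have hsk : Real.sqrt κ₃ ≠ 0 := (Real.sqrt_pos.2 hκ₃).ne'
    have hsb : Real.sqrt b ≠ 0 := (Real.sqrt_pos.2 hb).ne'
    have hκ3sq : Real.sqrt κ₃ * Real.sqrt κ₃ = κ₃ := Real.mul_self_sqrt hκ₃.le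
    field_simp
  rw [e1, e2]
  calc π ^ 2 * κ₁ * b⁻¹ * (π ^ 2 * κ₂ * b⁻¹) * (2 * C / ((1 + b / κ₃) * Real.sqrt (1 + b / κ₃)))
      ≤ π ^ 2 * κ₁ * b⁻¹ * (π ^ 2 * κ₂ * b⁻¹) * (2 * C / (b / κ₃ * Real.sqrt (b / κ₃))) := mul_le_mul_of_nonneg_left h3 (by positivity)
    _ = _ := by rw [e3]; ring

/-- Bernoulli: for `2 ≤ d`, `3/4 ≤ (1 − 1/(2d))^{d/2}`. [folklore] -/
theorem one_sub_inv_two_mul_rpow_ge {d : ℝ} (hd : 2 ≤ d) : (3 / 4 : ℝ) ≤ (1 - 1 / (2 * d)) ^ (d / 2) := by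
  have h := one_add_mul_self_le_rpow_one_add (s := -(1 / (2 * d))) (by
    have : 1 / (2 * d) ≤ 1 / 4 := by rw [div_le_div_iff₀ (by positivity) (by norm_num)]; linarith
    linarith) (p := d / 2) (by linarith)
  have e : 1 + d / 2 * -(1 / (2 * d)) = 3 / 4 := by field_simp; ring
  rw [e, show 1 + -(1 / (2 * d)) = 1 - 1 / (2 * d) by ring] at h
  exact h

/-- ★ The follower Gaussian prefactor: `(2π/((1−1/(2d))b))^{d/2} ≤ (4/3)·(2π/b)^{d/2}` for `2 ≤ d`, `0 < b`. [folklore] -/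
theorem folGauss_prefactor_le {d b : ℝ} (hd : 2 ≤ d) (hb : 0 < b) :
    (2 * π / ((1 - 1 / (2 * d)) * b)) ^ (d / 2) ≤ (4 / 3) * (2 * π / b) ^ (d / 2) := by
  have hq0 : 0 < 1 - 1 / (2 * d) := by
    have : 1 / (2 * d) ≤ 1 / 4 := by rw [div_le_div_iff₀ (by positivity) (by norm_num)]; linarith
    linarith
  have hB := one_sub_inv_two_mul_rpow_ge hd
  have hpos : 0 < (1 - 1 / (2 * d)) ^ (d / 2) := Real.rpow_pos_of_pos hq0 _
  have e : 2 * π / ((1 - 1 / (2 * d)) * b) = (2 * π / b) / (1 - 1 / (2 * d)) := by field_simp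
  rw [e, Real.div_rpow (by positivity) hq0.le]
  rw [div_le_iff₀ hpos]
  have h0 : 0 ≤ (2 * π / b) ^ (d / 2) := by positivity
  nlinarith [mul_le_mul_of_nonneg_left hB h0]

/-- The b-powers combine: `(b√b)⁻¹·b⁻¹·b⁻¹ = b^{−7/2}` and `b^{−7/2}·(2π/b)^{d/2} = (2π)^{−7/2}·(2π/b)^{(7+d)/2}` (`0 < b`). [folklore] -/
theorem b_pow_combine {b d : ℝ} (hb : 0 < b) :
    b⁻¹ * b⁻¹ * (b * Real.sqrt b)⁻¹ * (2 * π / b) ^ (d / 2) = (2 * π) ^ (-(7 / 2 : ℝ)) * (2 * π / b) ^ ((7 + d) / 2) := by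
  have h2π : 0 < 2 * π := by positivity
  have hbb : b⁻¹ * b⁻¹ * (b * Real.sqrt b)⁻¹ = b ^ (-(7 / 2 : ℝ)) := by
    rw [Real.sqrt_eq_rpow, Real.rpow_neg hb.le]
    rw [show (7 / 2 : ℝ) = 1 + 1 + (1 + 1 / 2) by norm_num, Real.rpow_add hb, Real.rpow_add hb, Real.rpow_add hb, Real.rpow_one]
    rw [mul_inv, mul_inv, mul_inv]
    ring
  rw [hbb, show ((7 + d) / 2 : ℝ) = 7 / 2 + d / 2 by ring, Real.rpow_add (div_pos h2π hb), Real.div_rpow h2π.le hb.le (7 / 2),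
    Real.rpow_neg h2π.le, Real.rpow_neg hb.le]
  have h1 : (2 * π) ^ (7 / 2 : ℝ) ≠ 0 := (Real.rpow_pos_of_pos h2π _).ne'
  have h2 : b ^ (7 / 2 : ℝ) ≠ 0 := (Real.rpow_pos_of_pos hb _).ne'
  field_simp

end Summit.QuantumFields.YangMills.Theorems.SwapVirialDeficit.SigmaBall

end
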